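import Summits.AtomisticToContinuum.BoseEinsteinCondensation.Theorems.BECDyadicChainingBaseCoherentMassNoClumpingAux
import Literature.MathematicalPhysics.QuantumManyBody.LiebYngvasonTheorem
import Literature.MathematicalPhysics.QuantumManyBody.DiluteBoseGasUpperBoundLocalization
import Literature.MathematicalPhysics.QuantumManyBody.BoseGasThermodynamicLimitRuelle
import Mathlib.Algebra.Order.Chebyshev

/-!
# Route `BECDyadicChaining`, crux `BaseCoherentMass` — stub `stub_noClumpingInteracting`

The TRUNCATED NO-CLUMPING of near-minimisers of the dilute interacting Bose gas (`a > 0`) on the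
interparticle scale, stub of the line `registered` of crux stmt-AtomisticToContinuum-13193 (lead).
For cells of a dyadic level `K` holding between `1` and `8` particles on average
(`8^K ≤ N < 8^{K+1}`, so the cell side `ℓ = L/2^K` has `ℓ³ ∈ [1/ρ, 8/ρ)` and tends to infinity as
`ρ → 0`): the expected cell numbers of every `1`-near-minimiser split as `Σ_j P(x_j ∈ B) ≤ m_B + o_B`
with `Σ_B m_B² ≤ (15/4) N²/8^K` and `Σ_B o_B ≤ N/200`.

Proof: the cell method STATE-WISE (`sum_cellWeight_mul_sum_le_energy`: Neumann cells,
cross-cell interactions dropped), the Lieb–Yngvason box bound (2.54) (`LSSY2005_boxLowerBound_holds`)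
with the crude parameters of `lyK_crude_parameters` (`K(p) ≥ 24/25` once `ℓ ≥ a y⁻⁶`,
`y = min(1/400, a/(2R₀+a))`, `p = 3001` FIXED), superadditivity (2.53), against Dyson's upper bound
`E₀ ≤ 4πρa(1 + C(ρa³)^{1/3})N` (`eventually_groundStateEnergy_le_dyson`) plus the slack `δ = 1`; the
bookkeeping is the registered ledger lemma (hypothesis, = `stub_cellLedger`) with threshold
`T = 1500`; finally `Σ_j P(x_j ∈ B) = Σ_σ w(σ) n_B(σ)` (`sum_setLIntegral_mem_dyCell_eq`) and
elementary arithmetic (`B ≤ (35/24) N²/8^K`, `O(T - 16) ≤ (14/3)N`).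

References: [LSSY2005] (2.44)–(2.56), Thm. 2.2; [LiebYngvason1998]; [Dyson1957].
-/

noncomputable section

namespace Summit.AtomisticToContinuum.BoseEinsteinCondensation.Theorems.BaseCoherentMass

open MeasureTheory Filter
open scoped ENNReal NNReal BigOperators
open Literature.MathematicalPhysics.QuantumManyBody.BoseGas

/-- `k (k - 1) ≥ 0` for a natural number `k` (read in `ℝ`). [folklore] -/
theorem natCast_mul_sub_one_nonneg (k : ℕ) : (0 : ℝ) ≤ k * (k - 1) := by
  rcases Nat.eq_zero_or_pos k with rfl | hk
  · simp
  · have : (1 : ℝ) ≤ k := by exact_mod_cast hk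
    exact mul_nonneg (by positivity) (by linarith)

/-- The real arithmetic behind the two outputs of the truncated no-clumping: if
`1500·O + Q ≤ B + N`, `S + O = N`, `S² ≤ G·Q`, `B ≤ (35/24) N²/G`, `G ≤ N < 8G`,
then `Q ≤ (15/4) N²/G` and `O ≤ N/200` (`Q = Σ m²`, `S = Σ m`, `O = Σ o`, `G = 8^K`). [folklore] -/
theorem noClumping_arith {S Q O B N G : ℝ} (hG : 0 < G) (hGN : G ≤ N) (hN8 : N < 8 * G)
    (hO : 0 ≤ O) (hledger : 1500 * O + Q ≤ B + N) (hsum : S + O = N)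
    (hCS : S ^ 2 ≤ G * Q) (hB : B ≤ 35 / 24 * N ^ 2 / G) :
    Q ≤ 15 / 4 * N ^ 2 / G ∧ O ≤ N / 200 := by
  have hN : 0 < N := hG.trans_le hGN
  have hNG : N ≤ N ^ 2 / G := by
    rw [le_div_iff₀ hG]; nlinarith
  constructor
  · have hx : 0 ≤ N ^ 2 / G := by positivity
    have e1 : 35 / 24 * N ^ 2 / G = 35 / 24 * (N ^ 2 / G) := by ring
    have e2 : 15 / 4 * N ^ 2 / G = 15 / 4 * (N ^ 2 / G) := by ring
    rw [e1] at hB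
    rw [e2]
    linarith
  · -- `S = N - O`, `(N - O)² ≤ G Q`, so `1500 O + (N-O)²/G ≤ B + N`
    have hS : S = N - O := by linarith
    have hQ' : (N - O) ^ 2 / G ≤ Q := by
      rw [div_le_iff₀ hG, ← hS]; linarith
    have h1 : 1500 * O + (N - O) ^ 2 / G ≤ 35 / 24 * N ^ 2 / G + N := by linarith
    -- multiply by `G`
    have h2 : 1500 * O * G + (N - O) ^ 2 ≤ 35 / 24 * N ^ 2 + N * G := by
      have := mul_le_mul_of_nonneg_right h1 hG.le
      rwa [add_mul, add_mul, div_mul_cancel₀ _ hG.ne', div_mul_cancel₀ _ hG.ne'] at this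
    -- `O (1500 G - 2N) ≤ (11/24) N² + N G ≤ (11/3) N G + N G`
    have h3 : O * (1500 * G - 2 * N) ≤ 11 / 24 * N ^ 2 + N * G := by nlinarith [sq_nonneg O]
    have h4 : 11 / 24 * N ^ 2 ≤ 11 / 3 * N * G := by nlinarith
    have h5 : 1484 * G ≤ 1500 * G - 2 * N := by linarith
    have h6 : O * (1484 * G) ≤ 14 / 3 * N * G := by
      calc O * (1484 * G) ≤ O * (1500 * G - 2 * N) := mul_le_mul_of_nonneg_left h5 hO
        _ ≤ 11 / 24 * N ^ 2 + N * G := h3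
        _ ≤ 11 / 3 * N * G + N * G := by linarith
        _ = 14 / 3 * N * G := by ring
    have h7 : O * 1484 ≤ 14 / 3 * N := by
      have h8 : O * 1484 * G ≤ 14 / 3 * N * G := by linarith [h6]
      exact le_of_mul_le_mul_right h8 hG
    linarith

/-- **Stub Q′ — truncated no-clumping of near-minimisers above the interparticle scale (`a > 0`)**,
from the registered ledger lemma (hypothesis). For every repulsive finite-range `v` with `a(v) > 0`
there are `M > 0` (here `M = 1`) and `ρ₀ > 0` such that for `0 < ρ < ρ₀`, eventually in `N`, for
`δ = 1`, every `δ`-near-minimiser `Ψ` of the Dirichlet energy in the box of side `L = (N/ρ)^{1/3}`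
satisfies, at every level `K` with `M 8^K ≤ N < 8M 8^K`: `Σ_j P(x_j ∈ B) ≤ m_B + o_B` with
`Σ_B m_B² ≤ (15/4) N²/8^K` and `Σ_B o_B ≤ N/200` (cell method state-wise, LY box bound with crude
constants, superadditivity, Dyson upper bound, ledger with `T = 1500`, `p = 3001`).
[cite: LSSY2005, (2.52)–(2.54), Thm. 2.2] -/
theorem stub_noClumpingInteracting :
    (∀ {ι S : Type} [Fintype ι] [Fintype S] (w : S → ℝ≥0∞) (_hw : ∑ s, w s = 1)
      (n : S → ι → ℕ) (N : ℕ) (_hn : ∀ s, ∑ i, n s i = N) (E : ℕ → ℝ≥0∞) (c : ℝ) (_hc : 0 < c)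
      (p T : ℕ) (_hT : 2 * T + 1 ≤ p)
      (_hbox : ∀ k : ℕ, k ≤ p → ENNReal.ofReal (c * k * (k - 1)) ≤ E k)
      (_hsup : ∀ q r : ℕ, (q : ℝ≥0∞) * E p ≤ E (q * p + r))
      (B : ℝ) (_hB : 0 ≤ B) (_hbudget : ∑ s, w s * ∑ i, E (n s i) ≤ ENNReal.ofReal (c * B)),
      ∃ m o : ι → ℝ≥0∞, (∀ i, ∑ s, w s * (n s i : ℝ≥0∞) = m i + o i) ∧
        (∑ i, (m i + o i)) = (N : ℝ≥0∞) ∧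
        (T : ℝ≥0∞) * ∑ i, o i + ∑ i, m i ^ 2 ≤ ENNReal.ofReal B + N) →
    ∀ v : ℝ → ℝ≥0∞, IsRepulsiveFiniteRange v → 0 < scatteringLength v →
    ∃ M : ℝ, 0 < M ∧ ∃ ρ₀ : ℝ, 0 < ρ₀ ∧ ∀ ρ : ℝ, 0 < ρ → ρ < ρ₀ → ∀ᶠ N : ℕ in Filter.atTop,
      ∃ δ : ℝ≥0∞, 0 < δ ∧ ∀ Ψ : TrialState N (sideLength ρ N),
        energy v Ψ ≤ groundStateEnergy v N (sideLength ρ N) + δ →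
        ∀ K : ℕ, M * 8 ^ K ≤ (N : ℝ) → (N : ℝ) < 8 * M * 8 ^ K →
          ∃ m o : (Fin 3 → Fin (2 ^ K)) → ℝ≥0∞,
            (∀ i, (∑ j : Fin N, ∫⁻ X in {X : Config N | X j ∈ dyCell (sideLength ρ N) K i},
                (‖Ψ.ψ X‖₊ : ℝ≥0∞) ^ 2) ≤ m i + o i) ∧
            ∑ i, m i ^ 2 ≤ ENNReal.ofReal (15 / 4 * (N : ℝ) ^ 2 / 8 ^ K) ∧
            ∑ i, o i ≤ ENNReal.ofReal ((N : ℝ) / 200) := by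
  intro hLedger v hv ha
  classical
  obtain ⟨hvm, R₀', hR₀'⟩ := hv
  -- the range and the scattering length
  set R₀ : ℝ := max R₀' 0 with hR₀_def
  have hR₀ : 0 ≤ R₀ := le_max_right _ _
  have hrange : ∀ r, R₀ < r → v r = 0 := fun r hr => hR₀' r ((le_max_left _ _).trans_lt hr)
  have haT : scatteringLength v ≠ ⊤ :=
    IsRepulsiveFiniteRange.scatteringLength_ne_top ⟨hvm, R₀', hR₀'⟩
  set a : ℝ := (scatteringLength v).toReal with ha_def
  have ha0 : 0 < a := ENNReal.toReal_pos ha.ne' haT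
  -- Dyson's upper bound
  obtain ⟨C, ρ₁, hC, hρ₁, HD⟩ := eventually_groundStateEnergy_le_dyson hrange hvm haT ha
  -- the fixed parameters `y`, `p = 3001`, `T = 1500`
  set y : ℝ := min (1 / 400) (a / (2 * R₀ + a)) with hy_def
  have hy : 0 < y := lt_min (by norm_num) (div_pos ha0 (by positivity))
  have hy1 : y ≤ 1 / 400 := min_le_left _ _
  have hy_lt_one : y < 1 := by linarith
  have hR₀a : 2 * R₀ * y ^ 5 ≤ a := by
    have hya : y ≤ a / (2 * R₀ + a) := min_le_right _ _
    have hyle1 : y ≤ 1 := hy_lt_one.le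
    have hy5 : y ^ 5 ≤ y := by
      calc y ^ 5 ≤ y ^ 1 := pow_le_pow_of_le_one hy.le hyle1 (by norm_num)
        _ = y := pow_one y
    have h1 : y * (2 * R₀ + a) ≤ a := by rwa [le_div_iff₀ (by positivity)] at hya
    nlinarith [mul_nonneg hR₀ hy.le, mul_nonneg hR₀ (pow_nonneg hy.le 5)]
  have hp8 : ((3001 : ℕ) : ℝ) * y ≤ 8 := by
    have h3001 : ((3001 : ℕ) : ℝ) = 3001 := by norm_num
    rw [h3001]
    linarith
  -- the density threshold
  set ρ₂ : ℝ := y ^ 18 / a ^ 3 with hρ₂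
  set ρ₃ : ℝ := (5 * C)⁻¹ ^ 3 / a ^ 3 with hρ₃
  refine ⟨1, one_pos, min ρ₁ (min ρ₂ ρ₃), lt_min hρ₁ (lt_min (by positivity) (by positivity)), ?_⟩
  intro ρ hρ hρlt
  have hρρ₁ : ρ < ρ₁ := hρlt.trans_le (min_le_left _ _)
  have hρρ₂ : ρ < ρ₂ := hρlt.trans_le ((min_le_right _ _).trans (min_le_left _ _))
  have hρρ₃ : ρ < ρ₃ := hρlt.trans_le ((min_le_right _ _).trans (min_le_right _ _))
  -- the Dyson error is at most `1/5`
  have hCY : C * (ρ * a ^ 3) ^ ((1 : ℝ) / 3) ≤ 1 / 5 := by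
    have h1 : ρ * a ^ 3 < (5 * C)⁻¹ ^ 3 := by
      rw [hρ₃, lt_div_iff₀ (by positivity)] at hρρ₃; exact hρρ₃
    have h2 : (ρ * a ^ 3) ^ ((1 : ℝ) / 3) ≤ (5 * C)⁻¹ := by
      have h3 : ((5 * C)⁻¹ ^ (3 : ℕ)) ^ ((1 : ℝ) / 3) = (5 * C)⁻¹ := by
        rw [← Real.rpow_natCast ((5 * C)⁻¹) 3, ← Real.rpow_mul (by positivity)]
        norm_num
      have := Real.rpow_le_rpow (by positivity) h1.le (by norm_num : (0 : ℝ) ≤ 1 / 3)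
      rwa [h3] at this
    calc C * (ρ * a ^ 3) ^ ((1 : ℝ) / 3) ≤ C * (5 * C)⁻¹ := by gcongr
      _ = 1 / 5 := by field_simp
  -- eventually in `N`
  filter_upwards [HD ρ hρ hρρ₁, Filter.eventually_ge_atTop ⌈5 / (4 * Real.pi * a * ρ)⌉₊,
    Filter.eventually_gt_atTop 0] with N hND hN5 hN0
  have hN5' : 5 / (4 * Real.pi * a * ρ) ≤ (N : ℝ) := (Nat.le_ceil _).trans (by exact_mod_cast hN5)
  have hNpos : (0 : ℝ) < N := Nat.cast_pos.mpr hN0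
  refine ⟨1, one_pos, ?_⟩
  -- the box side `L = (N/ρ)^{1/3}`, `L³ = N/ρ`
  have hL3 : sideLength ρ N ^ 3 = N / ρ := by
    have h0 : (0 : ℝ) ≤ N / ρ := div_nonneg (Nat.cast_nonneg N) hρ.le
    rw [sideLength, ← Real.rpow_natCast, ← Real.rpow_mul h0]; norm_num
  have hLpos : 0 < sideLength ρ N := Real.rpow_pos_of_pos (div_pos hNpos hρ) _
  set L : ℝ := sideLength ρ N with hL_def
  intro Ψ hΨ K hK1 hK2
  rw [one_mul] at hK1
  rw [mul_one] at hK2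
  -- geometry of the level: `ℓ = L/2^K`, `ℓ³ = N/(ρ 8^K) ≥ 1/ρ`
  have h8K : (0 : ℝ) < 8 ^ K := by positivity
  set ℓ : ℝ := L / 2 ^ K with hℓ_def
  have hℓpos : 0 < ℓ := by positivity
  have hℓ3 : ℓ ^ 3 = N / (ρ * 8 ^ K) := by
    rw [hℓ_def, div_pow, hL3, ← pow_mul, mul_comm K 3, pow_mul, div_div]; norm_num
  have hℓ_lower : a / y ^ 6 ≤ ℓ := by
    have h1 : (a / y ^ 6) ^ 3 ≤ ℓ ^ 3 := by
      rw [hℓ3, div_pow, ← pow_mul]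
      have h3 : a ^ 3 / y ^ (6 * 3) ≤ 1 / ρ := by
        rw [div_le_div_iff₀ (by positivity) hρ, show 6 * 3 = 18 by norm_num]
        rw [hρ₂, lt_div_iff₀ (by positivity)] at hρρ₂
        linarith
      have h4 : 1 / ρ ≤ N / (ρ * 8 ^ K) := by
        rw [div_le_div_iff₀ hρ (by positivity)]
        nlinarith [hK1]
      exact h3.trans h4
    exact le_of_pow_le_pow_left₀ three_ne_zero hℓpos.le h1
  -- the Lieb–Yngvason parameters at this scale: `K(p) ≥ 24/25`
  obtain ⟨hD, hTerr, hR₀R, h2R, hq, hKp16⟩ :=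
    lyK_crude_parameters a R₀ ℓ y 3001 ha0 hy hy1 hℓ_lower hp8 hR₀ hR₀a
  set Kp : ℝ := lyK a R₀ (ℓ * y) y ℓ 3001 with hKp_def
  have hKp1 : 24 / 25 ≤ Kp := by linarith
  have hKp0 : 0 < Kp := by linarith
  -- the cell energies, the box bound and superadditivity
  set E : ℕ → ℝ≥0∞ := fun k => neumannGroundStateEnergy v k ℓ with hE_def
  set c : ℝ := 4 * Real.pi * a * Kp / ℓ ^ 3 with hc_def
  have hc : 0 < c := by positivity
  have hbox : ∀ k : ℕ, k ≤ 3001 → ENNReal.ofReal (c * k * (k - 1)) ≤ E k := by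
    intro k hk
    have hDk : 0 < Real.pi * y / ℓ ^ 2 - 4 * a * k * (k - 1) / ℓ ^ 3 :=
      hD.trans_le (temple_denominator_anti ha0.le hℓpos hk)
    have hBB := LSSY2005_boxLowerBound_holds v R₀ hvm hR₀ hrange haT k ℓ y (ℓ * y) hy hy_lt_one
      hR₀R h2R hDk
    obtain ⟨-, hanti⟩ := lyK_anti ha0.le hy_lt_one.le hℓpos h2R.le hR₀ hR₀R hq hD hTerr hk
    refine le_trans (ENNReal.ofReal_le_ofReal ?_) hBB
    have hkk := natCast_mul_sub_one_nonneg k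
    calc c * k * (k - 1) = 4 * Real.pi * a / ℓ ^ 3 * (k * (k - 1)) * Kp := by rw [hc_def]; ring
      _ ≤ 4 * Real.pi * a / ℓ ^ 3 * (k * (k - 1)) * lyK a R₀ (ℓ * y) y ℓ k :=
          mul_le_mul_of_nonneg_left hanti (by positivity)
      _ = 4 * Real.pi * a / ℓ ^ 3 * k * (k - 1) * lyK a R₀ (ℓ * y) y ℓ k := by ring
  have hsup : ∀ q r : ℕ, (q : ℝ≥0∞) * E 3001 ≤ E (q * 3001 + r) := fun q r =>
    LSSY2005_superadditivity_holds.mul_le hvm hℓpos 3001 q r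
  -- the assignment weights and occupation numbers
  have hLℓ : ((2 ^ K : ℕ) : ℝ) * ℓ = L := by rw [hℓ_def]; push_cast; field_simp
  set w : (Fin N → Fin ((2 ^ K) ^ 3)) → ℝ≥0∞ := fun σ =>
    ∫⁻ X in cellSet (2 ^ K) ℓ σ, (‖Ψ.ψ X‖₊ : ℝ≥0∞) ^ 2 with hw_def
  have hw : ∑ σ, w σ = 1 := sum_cellWeight_eq_one hℓpos hLℓ Ψ
  set n : (Fin N → Fin ((2 ^ K) ^ 3)) → Fin ((2 ^ K) ^ 3) → ℕ := fun σ c' =>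
    (Finset.univ.filter fun i => σ i = c').card with hn_def
  have hn : ∀ σ, ∑ c', n σ c' = N := by
    intro σ
    rw [hn_def]
    exact (Finset.card_eq_sum_card_fiberwise (f := σ) (s := Finset.univ) (t := Finset.univ)
      fun _ _ => Finset.mem_univ _).symm.trans (by simp)
  -- the budget: Dyson + slack `1`
  set D : ℝ := 4 * Real.pi * ρ * a * (1 + C * (ρ * a ^ 3) ^ ((1 : ℝ) / 3)) with hD_def
  have hD0 : 0 ≤ D := by positivity
  set B : ℝ := (D * N + 1) / c with hB_def
  have hB0 : 0 ≤ B := by positivity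
  have hcB : c * B = D * N + 1 := by rw [hB_def]; field_simp
  have hbudget : ∑ σ, w σ * ∑ c', E (n σ c') ≤ ENNReal.ofReal (c * B) := by
    rw [hcB]
    calc ∑ σ, w σ * ∑ c', E (n σ c') ≤ energy v Ψ := sum_cellWeight_mul_sum_le_energy hvm hℓpos Ψ
      _ ≤ groundStateEnergy v N L + 1 := hΨ
      _ ≤ ENNReal.ofReal (D * N) + 1 := add_le_add hND le_rfl
      _ = ENNReal.ofReal (D * N + 1) := by
          rw [ENNReal.ofReal_add (by positivity) zero_le_one, ENNReal.ofReal_one]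
  -- the ledger
  obtain ⟨m, o, hmo, hsum, hledger⟩ :=
    hLedger w hw n N hn E c hc 3001 1500 (by norm_num) hbox hsup B hB0 hbudget
  -- finiteness and the passage to real numbers
  have hN_top : (N : ℝ≥0∞) ≠ ⊤ := ENNReal.natCast_ne_top N
  have hm_fin : ∀ c', m c' ≠ ⊤ := by
    intro c'
    refine ne_top_of_le_ne_top hN_top ?_
    rw [← hsum]
    exact le_trans le_self_add (Finset.single_le_sum (f := fun i => m i + o i)
      (fun _ _ => by positivity) (Finset.mem_univ c'))
  have hm_sum_fin : ∑ c', m c' ≠ ⊤ := ENNReal.sum_ne_top.2 fun c' _ => hm_fin c'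
  have ho_sum_fin : ∑ c', o c' ≠ ⊤ := by
    refine ne_top_of_le_ne_top hN_top ?_
    rw [← hsum]
    exact Finset.sum_le_sum fun i _ => le_add_self
  have hm2_sum_fin : ∑ c', m c' ^ 2 ≠ ⊤ :=
    ENNReal.sum_ne_top.2 fun c' _ => ENNReal.pow_ne_top (hm_fin c')
  set S : ℝ := ∑ c', (m c').toReal with hS_def
  set Q : ℝ := ∑ c', (m c').toReal ^ 2 with hQ_def
  set Or : ℝ := (∑ c', o c').toReal with hOr_def
  have hQ_eq : (∑ c', m c' ^ 2).toReal = Q := by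
    rw [ENNReal.toReal_sum (fun c' _ => ENNReal.pow_ne_top (hm_fin c'))]
    simp only [ENNReal.toReal_pow, hQ_def]
  have hS_eq : (∑ c', m c').toReal = S := by
    rw [ENNReal.toReal_sum (fun c' _ => hm_fin c')]
  have hsum_r : S + Or = N := by
    have h := congrArg ENNReal.toReal hsum
    rw [Finset.sum_add_distrib, ENNReal.toReal_add hm_sum_fin ho_sum_fin, hS_eq,
      ENNReal.toReal_natCast] at h
    exact h
  have hledger_r : 1500 * Or + Q ≤ B + N := by
    have hfin : ENNReal.ofReal B + (N : ℝ≥0∞) ≠ ⊤ := ENNReal.add_ne_top.2 ⟨ENNReal.ofReal_ne_top, hN_top⟩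
    have h := ENNReal.toReal_mono hfin hledger
    rw [ENNReal.toReal_add (ENNReal.mul_ne_top (ENNReal.natCast_ne_top _) ho_sum_fin) hm2_sum_fin,
      ENNReal.toReal_mul, ENNReal.toReal_natCast, hQ_eq, ENNReal.toReal_add ENNReal.ofReal_ne_top hN_top,
      ENNReal.toReal_ofReal hB0, ENNReal.toReal_natCast] at h
    push_cast at h
    linarith
  have hOr0 : 0 ≤ Or := ENNReal.toReal_nonneg
  have hCS : S ^ 2 ≤ (8 : ℝ) ^ K * Q := by
    have h := sq_sum_le_card_mul_sum_sq (s := (Finset.univ : Finset (Fin ((2 ^ K) ^ 3))))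
      (f := fun c' => (m c').toReal)
    rw [Finset.card_univ, Fintype.card_fin] at h
    have h8 : (((2 ^ K) ^ 3 : ℕ) : ℝ) = (8 : ℝ) ^ K := by
      push_cast
      rw [← pow_mul, mul_comm K 3, pow_mul]; norm_num
    rw [h8] at h
    exact h
  -- the budget in real terms: `B ≤ (35/24) N²/8^K`
  have hBr : B ≤ 35 / 24 * (N : ℝ) ^ 2 / 8 ^ K := by
    have key : (D * N + 1) * N ≤ 35 / 24 * (N : ℝ) ^ 2 * (4 * Real.pi * a * Kp * ρ) := by
      have h1 : D ≤ 4 * Real.pi * ρ * a * (6 / 5) := by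
        rw [hD_def]; exact mul_le_mul_of_nonneg_left (by linarith [hCY]) (by positivity)
      have h2 : 1 ≤ 4 / 5 * Real.pi * a * ρ * N := by
        have := hN5'; rw [div_le_iff₀ (by positivity)] at this; linarith
      calc (D * N + 1) * N = D * N ^ 2 + 1 * N := by ring
        _ ≤ 4 * Real.pi * ρ * a * (6 / 5) * N ^ 2 + (4 / 5 * Real.pi * a * ρ * N) * N :=
            add_le_add (mul_le_mul_of_nonneg_right h1 (sq_nonneg _))
              (mul_le_mul_of_nonneg_right h2 hNpos.le)
        _ = 35 / 24 * (N : ℝ) ^ 2 * (4 * Real.pi * a * (24 / 25) * ρ) := by ring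
        _ ≤ 35 / 24 * (N : ℝ) ^ 2 * (4 * Real.pi * a * Kp * ρ) := by gcongr
    have hKpne : Kp ≠ 0 := hKp0.ne'
    have hρne : ρ ≠ 0 := hρ.ne'
    have hane : a ≠ 0 := ha0.ne'
    have hB_eq : B = (D * N + 1) * N / (4 * Real.pi * a * Kp * ρ * 8 ^ K) := by
      rw [hB_def, hc_def, hℓ3]
      field_simp
    rw [hB_eq, div_le_div_iff₀ (by positivity) h8K]
    calc (D * N + 1) * N * 8 ^ K ≤ 35 / 24 * (N : ℝ) ^ 2 * (4 * Real.pi * a * Kp * ρ) * 8 ^ K :=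
          mul_le_mul_of_nonneg_right key h8K.le
      _ = 35 / 24 * (N : ℝ) ^ 2 * (4 * Real.pi * a * Kp * ρ * 8 ^ K) := by ring
  obtain ⟨hQb, hOb⟩ := noClumping_arith h8K hK1 hK2 hOr0 hledger_r hsum_r hCS hBr
  -- the outputs, re-indexed by the lattice coordinates of the cells
  set e : (Fin 3 → Fin (2 ^ K)) ≃ Fin ((2 ^ K) ^ 3) := finFunctionFinEquiv with he
  refine ⟨fun i => m (e i), fun i => o (e i), fun i => ?_, ?_, ?_⟩
  · show (∑ j : Fin N, ∫⁻ X in {X : Config N | X j ∈ dyCell L K i}, (‖Ψ.ψ X‖₊ : ℝ≥0∞) ^ 2) ≤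
      m (e i) + o (e i)
    rw [sum_setLIntegral_mem_dyCell_eq hLpos Ψ K i]
    exact le_of_eq (hmo (e i))
  · calc ∑ i, m (e i) ^ 2 = ∑ c', m c' ^ 2 := Equiv.sum_comp e (fun c' => m c' ^ 2)
      _ = ENNReal.ofReal Q := by rw [← hQ_eq, ENNReal.ofReal_toReal hm2_sum_fin]
      _ ≤ ENNReal.ofReal (15 / 4 * (N : ℝ) ^ 2 / 8 ^ K) := ENNReal.ofReal_le_ofReal hQb
  · calc ∑ i, o (e i) = ∑ c', o c' := Equiv.sum_comp e o
      _ = ENNReal.ofReal Or := (ENNReal.ofReal_toReal ho_sum_fin).symm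
      _ ≤ ENNReal.ofReal ((N : ℝ) / 200) := ENNReal.ofReal_le_ofReal hOb

end Summit.AtomisticToContinuum.BoseEinsteinCondensation.Theorems.BaseCoherentMass

end
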